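import Summits.ResolutionOfSingularities.ResolutionOfSingularities.Theorems.EquisingularLiftEquisingularLiftNatSecondOrderAPoints
import HarnessLib

/-!
# [OURS] `A₃` RECOGNITION in polynomial currency (every field, every characteristic): tangent cone `y₀y₁`, no `y₂³` in the cubic form, and
# NON-ZERO DISCRIMINANT `γ - αβ` of the exceptional tangent cone ⟹ after ONE blow-up exactly one candidate singular point over the vertex,
# a NODE, which is a one-step point — LEVEL EXACTLY `1`
# (cruxes `Theses.EquisingularLift.EquisingularLiftNat` / `…NatThree` / `EquisingularLift`, stmt-ResolutionOfSingularities-20038 / -20148 / -15660)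

[OURS · leafhand-res-equisingularlift-11 g0, 2026-08-31; cell `pub/decomp-res`] AI-produced, weaker than expert review; NOT a statement of any manuscript;
nothing here proves resolution of singularities in positive characteristic.  DEF-FREE helper; no `sorry`; standard axioms; ZERO named hypotheses.

Sequel of ✓ `…NatSecondOrderAPoints` (p832392).  The vertex chart is written, as a user meets it, as

  `f = y₀y₁ + (y₂²·(α y₀ + β y₁) + Ψ₁⁰) + (γ·y₂⁴ + Ψ₂⁰ + Ψ₅)`

with `Ψ₁⁰ ∈ (y₀, y₁)²` a cubic form (so the whole cubic form `Ψ₁ = y₂²(αy₀ + βy₁) + Ψ₁⁰` has NO `y₂³` term — otherwise the point is `A₂`,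
first-order, ✓ `FirstOrderPoint.firstOrder_A₂`), `Ψ₂⁰ ∈ (y₀, y₁)` a quartic form (the quartic form is `γy₂⁴ + Ψ₂⁰`) and `Ψ₅ ∈ (y)⁵` arbitrary.
In chart `2` (`y₀ ↦ T₂T₀`, `y₁ ↦ T₂T₁`, `y₂ ↦ T₂`) the strict transform is

  `G₂ = Φ' + Ψ_{≥3}`,  `Φ' = T₀T₁ + α T₀T₂ + β T₁T₂ + γ T₂² = (T₀ + βT₂)(T₁ + αT₂) + (γ - αβ)·T₂²`,  `Ψ_{≥3} ∈ (T)³`,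

so the exceptional point (the origin of chart `2`, the only candidate by the product-chart lemma) has tangent cone the quadric `Φ'`, of rank `3`
(a NODE) iff the DISCRIMINANT `γ - αβ` is non-zero — the `A₃` case; for `γ = αβ` the rank is `2` again (`A_k`, `k ≥ 4`, descends to `A_{k-2}`).

* `SecondOrderPoint.sub_homogeneousComponent_mem_pow_succ` — ORDER SPLITTING: `p ∈ (T)^k ⟹ p - p_[k] ∈ (T)^{k+1}` (`p_[k]` the homogeneous
  component): every `Ψ_{≥3}` splits as a cubic form plus an order-`≥ 4` tail, the input format of ✓ `FirstOrderPoint.exists_strictTransform`;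
* `SecondOrderPoint.firstOrder_node_disc` — (FO) for the quadric `Φ'` with `γ ≠ αβ` and ANY next form, every characteristic, directly from
  `∂₀Φ' = T₁ + αT₂`, `∂₁Φ' = T₀ + βT₂` and `Φ' ≡ (γ - αβ)T₂² (mod ∂₀Φ', ∂₁Φ')`;
* `SecondOrderPoint.aeval_update₂_mem_span01(_sq)` — the dehomogenisation `y₂ := 1` preserves `(y₀, y₁)` and `(y₀, y₁)²`;
* ★★★ `SecondOrderPoint.A₃_recognition_chart₂` — for `f` as displayed with `γ ≠ αβ`: a cubic form `Ψ₁'` and `Ψ'' ∈ (T)⁴` with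
  (i) `f(T₂T₀, T₂T₁, T₂) = T₂²·G₂`, `G₂ = Φ' + (Ψ₁' + Ψ'')`; (ii) an ideal containing `T₂, ∂₀G₂, ∂₁G₂` contains all `T_i`; (iii) the origin of
  chart `2` is ONE-STEP for `G₂`: for every chart direction an explicit strict transform of `G₂` with its total-transform identity and Jacobian
  certificate along the exceptional divisor;
* ★ `SecondOrderPoint.A₃_recognition_charts₀₁` — charts `0`, `1` regular along `E` (✓ `A_charts_regular_off_origin₂`);
* ★ `SecondOrderPoint.A₃_recognition_not_firstOrder` — `f` itself is NOT first-order (`b = e₂` kills `Φ = y₀y₁`, `∇Φ` and `Ψ₁`, as `Ψ₁⁰ ∈ (y₀,y₁)²`).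

Remaining (scheme side, unchanged, M–L): the bridge to ✓ `towerLevel_succ_of_model`.  Honest label: pure algebra; closes no registered stub.

References: [Hartshorne1977, I Thm. 5.1, I Ex. 5.6 (blowing up curve and surface singularities), II Ex. 7.12]; `A_k ↦ A_{k-2}` under the blow-up of
the point is classical; through the cited tree files.
-/

set_option linter.dupNamespace false -- mandated namespace `Summit.<Summit>.<Problem>` of this single-conjunct summit

noncomputable section

open MvPolynomial

namespace Summit.ResolutionOfSingularities.ResolutionOfSingularities.Cruxes.EquisingularLiftNat.Sections

namespace SecondOrderPoint

variable (K : Type) [Field K] {n : ℕ}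

/-! ## Order splitting -/

/-- **ORDER SPLITTING**: if `p ∈ (T)^k` then `p - p_[k] ∈ (T)^{k+1}`, `p_[k]` the homogeneous component of degree `k`. [folklore] -/
theorem sub_homogeneousComponent_mem_pow_succ {p : MvPolynomial (Fin n) K} {k : ℕ}
    (hp : p ∈ Ideal.span (Set.range (X : Fin n → MvPolynomial (Fin n) K)) ^ k) :
    p - homogeneousComponent k p ∈ Ideal.span (Set.range (X : Fin n → MvPolynomial (Fin n) K)) ^ (k + 1) := by
  change p - homogeneousComponent k p ∈ MvPolynomial.idealOfVars (Fin n) K ^ (k + 1)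
  have hp' : p ∈ MvPolynomial.idealOfVars (Fin n) K ^ k := hp
  rw [MvPolynomial.mem_pow_idealOfVars_iff'] at hp' ⊢
  intro x hx
  rw [coeff_sub, coeff_homogeneousComponent]
  by_cases hxk : x.degree = k
  · rw [if_pos hxk, sub_self]
  · rw [if_neg hxk, sub_zero]
    exact hp' x (by omega)

/-! ## The node with discriminant -/

/-- A non-zero scalar factor can be cancelled inside a prime ideal. [folklore] -/
theorem mem_of_C_mul_mem {c : K} (hc : c ≠ 0) {q : MvPolynomial (Fin n) K} (P : Ideal (MvPolynomial (Fin n) K)) (hP : P.IsPrime)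
    (h : C c * q ∈ P) : q ∈ P := by
  rcases hP.mem_or_mem h with h1 | h2
  · exact absurd (P.eq_top_of_isUnit_mem h1 ((isUnit_iff_ne_zero.mpr hc).map C)) hP.ne_top
  · exact h2

/-- **(FO) for the quadric `Φ' = T₀T₁ + αT₀T₂ + βT₁T₂ + γT₂²` with non-zero discriminant `γ - αβ`**, any next form `Ψ₁`, every characteristic:
a prime containing `Φ'`, `∂₀Φ' = T₁ + αT₂` and `∂₁Φ' = T₀ + βT₂` contains `(γ - αβ)T₂²` (`Φ' = (T₀ + βT₂)(T₁ + αT₂) + (γ - αβ)T₂²`), hence `T₂`,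
hence `T₀, T₁`. [cite: Hartshorne1977, I Thm. 5.1] -/
theorem firstOrder_node_disc (α β γ : K) (hdisc : γ ≠ α * β) (Ψ₁ : MvPolynomial (Fin 3) K) (P : Ideal (MvPolynomial (Fin 3) K))
    (hP : P.IsPrime) (hΦ : (X 0 * X 1 + C α * (X 0 * X 2) + C β * (X 1 * X 2) + C γ * X 2 ^ 2 : MvPolynomial (Fin 3) K) ∈ P)
    (hd : ∀ i, pderiv i (X 0 * X 1 + C α * (X 0 * X 2) + C β * (X 1 * X 2) + C γ * X 2 ^ 2 : MvPolynomial (Fin 3) K) ∈ P)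
    (_hΨ : Ψ₁ ∈ P) (i : Fin 3) : (X i : MvPolynomial (Fin 3) K) ∈ P := by
  have e0 : (X 1 + C α * X 2 : MvPolynomial (Fin 3) K) ∈ P := by
    have h := hd 0
    have hc : pderiv 0 (X 0 * X 1 + C α * (X 0 * X 2) + C β * (X 1 * X 2) + C γ * X 2 ^ 2 : MvPolynomial (Fin 3) K) = X 1 + C α * X 2 := by
      simp only [map_add, pderiv_mul, pderiv_C, pderiv_pow, pderiv_X_self, pderiv_X_of_ne (show (1 : Fin 3) ≠ 0 by decide),
        pderiv_X_of_ne (show (2 : Fin 3) ≠ 0 by decide)]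
      ring
    rwa [hc] at h
  have e1 : (X 0 + C β * X 2 : MvPolynomial (Fin 3) K) ∈ P := by
    have h := hd 1
    have hc : pderiv 1 (X 0 * X 1 + C α * (X 0 * X 2) + C β * (X 1 * X 2) + C γ * X 2 ^ 2 : MvPolynomial (Fin 3) K) = X 0 + C β * X 2 := by
      simp only [map_add, pderiv_mul, pderiv_C, pderiv_pow, pderiv_X_self, pderiv_X_of_ne (show (0 : Fin 3) ≠ 1 by decide),
        pderiv_X_of_ne (show (2 : Fin 3) ≠ 1 by decide)]
      ring
    rwa [hc] at h
  have e2 : (C (γ - α * β) * X 2 ^ 2 : MvPolynomial (Fin 3) K) ∈ P := by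
    have h : (C (γ - α * β) * X 2 ^ 2 : MvPolynomial (Fin 3) K) =
        (X 0 * X 1 + C α * (X 0 * X 2) + C β * (X 1 * X 2) + C γ * X 2 ^ 2) - (X 0 + C β * X 2) * (X 1 + C α * X 2) := by
      rw [map_sub, map_mul]; ring
    rw [h]
    exact P.sub_mem hΦ (P.mul_mem_left _ e0)
  have h2 : (X 2 : MvPolynomial (Fin 3) K) ∈ P :=
    hP.mem_of_pow_mem 2 (mem_of_C_mul_mem K (sub_ne_zero.mpr hdisc) P hP e2)
  have h1 : (X 1 : MvPolynomial (Fin 3) K) ∈ P := by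
    have h : (X 1 : MvPolynomial (Fin 3) K) = (X 1 + C α * X 2) - C α * X 2 := by ring
    rw [h]; exact P.sub_mem e0 (P.mul_mem_left _ h2)
  have h0 : (X 0 : MvPolynomial (Fin 3) K) ∈ P := by
    have h : (X 0 : MvPolynomial (Fin 3) K) = (X 0 + C β * X 2) - C β * X 2 := by ring
    rw [h]; exact P.sub_mem e1 (P.mul_mem_left _ h2)
  fin_cases i
  · exact h0
  · exact h1
  · exact h2

/-! ## The dehomogenisation `y₂ := 1` preserves `(y₀, y₁)` -/

/-- The substitution `y₂ := 1` maps the ideal `(y₀, y₁)` onto itself. [folklore] -/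
theorem map_update₂_span01 :
    Ideal.map (aeval (Function.update (X : Fin 3 → MvPolynomial (Fin 3) K) 2 1)).toRingHom
        (Ideal.span {(X 0 : MvPolynomial (Fin 3) K), X 1}) = Ideal.span {(X 0 : MvPolynomial (Fin 3) K), X 1} := by
  rw [Ideal.map_span, Set.image_pair]
  simp only [AlgHom.toRingHom_eq_coe, RingHom.coe_coe, aeval_X]
  rw [Function.update_of_ne (by decide : (0 : Fin 3) ≠ 2), Function.update_of_ne (by decide : (1 : Fin 3) ≠ 2)]

/-- `p ∈ (y₀, y₁) ⟹ p(ŷ) ∈ (T₀, T₁)` for `ŷ = (y with y₂ := 1)`. [folklore] -/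
theorem aeval_update₂_mem_span01 {p : MvPolynomial (Fin 3) K} (hp : p ∈ Ideal.span {(X 0 : MvPolynomial (Fin 3) K), X 1}) :
    aeval (Function.update (X : Fin 3 → MvPolynomial (Fin 3) K) 2 1) p ∈ Ideal.span {(X 0 : MvPolynomial (Fin 3) K), X 1} := by
  have h := Ideal.mem_map_of_mem (aeval (Function.update (X : Fin 3 → MvPolynomial (Fin 3) K) 2 1)).toRingHom hp
  rwa [map_update₂_span01] at h

/-- `p ∈ (y₀, y₁)² ⟹ p(ŷ) ∈ (T₀, T₁)²`. [folklore] -/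
theorem aeval_update₂_mem_span01_sq {p : MvPolynomial (Fin 3) K} (hp : p ∈ Ideal.span {(X 0 : MvPolynomial (Fin 3) K), X 1} ^ 2) :
    aeval (Function.update (X : Fin 3 → MvPolynomial (Fin 3) K) 2 1) p ∈ Ideal.span {(X 0 : MvPolynomial (Fin 3) K), X 1} ^ 2 := by
  have h := Ideal.mem_map_of_mem (aeval (Function.update (X : Fin 3 → MvPolynomial (Fin 3) K) 2 1)).toRingHom hp
  rwa [Ideal.map_pow, map_update₂_span01] at h

/-- `(T₀, T₁) ≤ (T)`. [folklore] -/
theorem span01_le_span : Ideal.span {(X 0 : MvPolynomial (Fin 3) K), X 1} ≤ Ideal.span (Set.range (X : Fin 3 → MvPolynomial (Fin 3) K)) :=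
  Ideal.span_mono (by
    rintro _ (rfl | rfl)
    · exact ⟨0, rfl⟩
    · exact ⟨1, rfl⟩)

/-! ## ★★★ `A₃` recognition -/

/-- ★★★ **`A₃` RECOGNITION, chart `2`** (every field).  `f = y₀y₁ + (y₂²(αy₀ + βy₁) + Ψ₁⁰) + (γy₂⁴ + Ψ₂⁰ + Ψ₅)` with `Ψ₁⁰ ∈ (y₀,y₁)²` a cubic form,
`Ψ₂⁰ ∈ (y₀,y₁)` a quartic form, `Ψ₅ ∈ (y)⁵`, and `γ ≠ αβ`.  Then there are a cubic form `Ψ₁'` and `Ψ'' ∈ (T)⁴` such that, with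
`Φ' = T₀T₁ + αT₀T₂ + βT₁T₂ + γT₂²` and `G₂ = Φ' + (Ψ₁' + Ψ'')`: (i) `f(T₂T₀, T₂T₁, T₂) = T₂²·G₂`; (ii) an ideal containing `T₂`, `∂₀G₂`, `∂₁G₂`
contains every `T_i` (the strict transform meets `E` singularly at most at the origin); (iii) the origin is ONE-STEP for `G₂`: for every chart direction
`l` a strict transform `G'` with `G₂(T_l, T_lT_j) = T_l²·G'` and the Jacobian certificate at every prime `P ∋ T_l, G'`.
[cite: Hartshorne1977, I Thm. 5.1, II Ex. 7.12] -/
theorem A₃_recognition_chart₂ (α β γ : K) (hdisc : γ ≠ α * β) {Ψ₁₀ Ψ₂₀ Ψ₅ : MvPolynomial (Fin 3) K}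
    (hΨ₁₀h : Ψ₁₀.IsHomogeneous 3) (hΨ₁₀ : Ψ₁₀ ∈ Ideal.span {(X 0 : MvPolynomial (Fin 3) K), X 1} ^ 2)
    (hΨ₂₀h : Ψ₂₀.IsHomogeneous 4) (hΨ₂₀ : Ψ₂₀ ∈ Ideal.span {(X 0 : MvPolynomial (Fin 3) K), X 1})
    (hΨ₅ : Ψ₅ ∈ Ideal.span (Set.range (X : Fin 3 → MvPolynomial (Fin 3) K)) ^ 5) :
    ∃ Ψ₁' Ψ'' : MvPolynomial (Fin 3) K, Ψ₁'.IsHomogeneous 3 ∧ Ψ'' ∈ Ideal.span (Set.range (X : Fin 3 → MvPolynomial (Fin 3) K)) ^ 4 ∧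
      aeval (fun j => X 2 * Function.update (X : Fin 3 → MvPolynomial (Fin 3) K) 2 1 j)
          (X 0 * X 1 + (X 2 ^ 2 * (C α * X 0 + C β * X 1) + Ψ₁₀) + (C γ * X 2 ^ 4 + Ψ₂₀ + Ψ₅)) =
        X 2 ^ 2 * ((X 0 * X 1 + C α * (X 0 * X 2) + C β * (X 1 * X 2) + C γ * X 2 ^ 2) + (Ψ₁' + Ψ'')) ∧
      (∀ P : Ideal (MvPolynomial (Fin 3) K), (X 2 : MvPolynomial (Fin 3) K) ∈ P →
        pderiv 0 ((X 0 * X 1 + C α * (X 0 * X 2) + C β * (X 1 * X 2) + C γ * X 2 ^ 2) + (Ψ₁' + Ψ'')) ∈ P →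
        pderiv 1 ((X 0 * X 1 + C α * (X 0 * X 2) + C β * (X 1 * X 2) + C γ * X 2 ^ 2) + (Ψ₁' + Ψ'')) ∈ P →
        ∀ i, (X i : MvPolynomial (Fin 3) K) ∈ P) ∧
      ∀ l : Fin 3, ∃ G' : MvPolynomial (Fin 3) K,
        aeval (fun j => X l * Function.update (X : Fin 3 → MvPolynomial (Fin 3) K) l 1 j)
            ((X 0 * X 1 + C α * (X 0 * X 2) + C β * (X 1 * X 2) + C γ * X 2 ^ 2) + (Ψ₁' + Ψ'')) = X l ^ 2 * G' ∧
        ∀ P : Ideal (MvPolynomial (Fin 3) K), P.IsPrime → (X l : MvPolynomial (Fin 3) K) ∈ P → G' ∈ P → ∃ j, pderiv j G' ∉ P := by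
  set u : Fin 3 → MvPolynomial (Fin 3) K := Function.update (X : Fin 3 → MvPolynomial (Fin 3) K) 2 1 with hu
  obtain ⟨R₅, hR₅⟩ := FirstOrderPoint.exists_aeval_subst_eq_pow_mul K 2 hΨ₅
  -- the order-≥3 part of the strict transform
  set E : MvPolynomial (Fin 3) K := X 2 * aeval u Ψ₁₀ + X 2 ^ 2 * aeval u Ψ₂₀ + X 2 ^ 3 * R₅ with hE
  have hI : (X 2 : MvPolynomial (Fin 3) K) ∈ Ideal.span (Set.range (X : Fin 3 → MvPolynomial (Fin 3) K)) :=
    Ideal.subset_span (Set.mem_range_self (2 : Fin 3))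
  have hE3 : E ∈ Ideal.span (Set.range (X : Fin 3 → MvPolynomial (Fin 3) K)) ^ 3 := by
    refine Ideal.add_mem _ (Ideal.add_mem _ ?_ ?_) ?_
    · rw [pow_succ']
      exact Ideal.mul_mem_mul hI (Ideal.pow_right_mono (span01_le_span K) 2 (aeval_update₂_mem_span01_sq K hΨ₁₀))
    · rw [pow_succ]
      exact Ideal.mul_mem_mul (Ideal.pow_mem_pow hI 2) (span01_le_span K (aeval_update₂_mem_span01 K hΨ₂₀))
    · exact Ideal.mul_mem_right _ _ (Ideal.pow_mem_pow hI 3)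
  refine ⟨homogeneousComponent 3 E, E - homogeneousComponent 3 E, homogeneousComponent_isHomogeneous 3 E,
    sub_homogeneousComponent_mem_pow_succ K hE3, ?_, ?_, ?_⟩
  · -- (i) the total-transform identity
    have hα : (X 2 ^ 2 * (C α * X 0 + C β * X 1) : MvPolynomial (Fin 3) K).IsHomogeneous 3 := by
      have h := (isHomogeneous_X_pow (2 : Fin 3) 2 (R := K)).mul
        (((isHomogeneous_C (Fin 3) α).mul (isHomogeneous_X K (0 : Fin 3))).add
          ((isHomogeneous_C (Fin 3) β).mul (isHomogeneous_X K (1 : Fin 3))))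
      simpa using h
    have hγ : (C γ * X 2 ^ 4 : MvPolynomial (Fin 3) K).IsHomogeneous 4 := by
      simpa using (isHomogeneous_C (Fin 3) γ).mul (isHomogeneous_X_pow (2 : Fin 3) 4 (R := K))
    rw [map_add, map_add, map_add, map_add, map_add, aeval_subst_X_mul_X_of_ne K 2 0 1 (by decide) (by decide),
      FirstOrderPoint.aeval_subst_of_isHomogeneous K 2 hα, FirstOrderPoint.aeval_subst_of_isHomogeneous K 2 hΨ₁₀h,
      FirstOrderPoint.aeval_subst_of_isHomogeneous K 2 hγ, FirstOrderPoint.aeval_subst_of_isHomogeneous K 2 hΨ₂₀h, hR₅, ← hu]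
    have h1 : aeval u (X 2 ^ 2 * (C α * X 0 + C β * X 1) : MvPolynomial (Fin 3) K) = C α * X 0 + C β * X 1 := by
      rw [map_mul, map_pow, aeval_X, map_add, map_mul, map_mul, aeval_C, aeval_C, aeval_X, aeval_X, hu, Function.update_self,
        Function.update_of_ne (by decide : (0 : Fin 3) ≠ 2), Function.update_of_ne (by decide : (1 : Fin 3) ≠ 2), algebraMap_eq]
      ring
    have h2 : aeval u (C γ * X 2 ^ 4 : MvPolynomial (Fin 3) K) = C γ := by
      rw [map_mul, map_pow, aeval_C, aeval_X, hu, Function.update_self, algebraMap_eq]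
      ring
    rw [h1, h2, add_sub_cancel, hE]
    ring
  · -- (ii) product chart
    intro P hP2 h0 h1 i
    refine forall_X_mem_of_sub_mul_mem_span₃ K ?_ P hP2 h0 h1 i
    refine Ideal.mem_span_singleton'.mpr ⟨C α * X 0 + C β * X 1 + C γ * X 2 + (aeval u Ψ₁₀ + X 2 * aeval u Ψ₂₀ + X 2 ^ 2 * R₅), ?_⟩
    rw [add_sub_cancel, hE]
    ring
  · -- (iii) the exceptional point is first-order: node with discriminant
    intro l
    have hΦ' : (X 0 * X 1 + C α * (X 0 * X 2) + C β * (X 1 * X 2) + C γ * X 2 ^ 2 : MvPolynomial (Fin 3) K).IsHomogeneous 2 := by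
      have h01 := (isHomogeneous_X K (0 : Fin 3)).mul (isHomogeneous_X K (1 : Fin 3))
      have h02 := (isHomogeneous_C (Fin 3) α).mul ((isHomogeneous_X K (0 : Fin 3)).mul (isHomogeneous_X K (2 : Fin 3)))
      have h12 := (isHomogeneous_C (Fin 3) β).mul ((isHomogeneous_X K (1 : Fin 3)).mul (isHomogeneous_X K (2 : Fin 3)))
      have h22 := (isHomogeneous_C (Fin 3) γ).mul (isHomogeneous_X_pow (2 : Fin 3) 2 (R := K))
      have h := ((h01.add (by simpa using h02)).add (by simpa using h12)).add (by simpa using h22)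
      simpa using h
    exact FirstOrderPoint.exists_strictTransform K _ _ _ hΦ' (homogeneousComponent_isHomogeneous 3 E)
      (sub_homogeneousComponent_mem_pow_succ K hE3)
      (fun P hP hΦP hdP hΨP => firstOrder_node_disc K α β γ hdisc _ P hP hΦP hdP hΨP) l

/-- ★ **`A₃` recognition, charts `0` and `1`**: regular along the exceptional divisor (graph charts, ✓ `A_charts_regular_off_origin₂`; the whole tail
`Ψ = (y₂²(αy₀ + βy₁) + Ψ₁⁰) + (γy₂⁴ + Ψ₂⁰ + Ψ₅)` lies in `(y)³`). [cite: Hartshorne1977, I Thm. 5.1, II Ex. 7.12] -/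
theorem A₃_recognition_charts₀₁ (α β γ : K) {Ψ₁₀ Ψ₂₀ Ψ₅ : MvPolynomial (Fin 3) K}
    (hΨ₁₀ : Ψ₁₀ ∈ Ideal.span (Set.range (X : Fin 3 → MvPolynomial (Fin 3) K)) ^ 3)
    (hΨ₂₀ : Ψ₂₀ ∈ Ideal.span (Set.range (X : Fin 3 → MvPolynomial (Fin 3) K)) ^ 4)
    (hΨ₅ : Ψ₅ ∈ Ideal.span (Set.range (X : Fin 3 → MvPolynomial (Fin 3) K)) ^ 5) :
    (∃ G : MvPolynomial (Fin 3) K,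
      aeval (fun j => X 0 * Function.update (X : Fin 3 → MvPolynomial (Fin 3) K) 0 1 j)
          (X 0 * X 1 + ((X 2 ^ 2 * (C α * X 0 + C β * X 1) + Ψ₁₀) + (C γ * X 2 ^ 4 + Ψ₂₀ + Ψ₅))) = X 0 ^ 2 * G ∧
      ∀ P : Ideal (MvPolynomial (Fin 3) K), P.IsPrime → (X 0 : MvPolynomial (Fin 3) K) ∈ P → ∃ j, pderiv j G ∉ P) ∧
    (∃ G : MvPolynomial (Fin 3) K,
      aeval (fun j => X 1 * Function.update (X : Fin 3 → MvPolynomial (Fin 3) K) 1 1 j)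
          (X 0 * X 1 + ((X 2 ^ 2 * (C α * X 0 + C β * X 1) + Ψ₁₀) + (C γ * X 2 ^ 4 + Ψ₂₀ + Ψ₅))) = X 1 ^ 2 * G ∧
      ∀ P : Ideal (MvPolynomial (Fin 3) K), P.IsPrime → (X 1 : MvPolynomial (Fin 3) K) ∈ P → ∃ j, pderiv j G ∉ P) := by
  set I : Ideal (MvPolynomial (Fin 3) K) := Ideal.span (Set.range (X : Fin 3 → MvPolynomial (Fin 3) K)) with hIdef
  have hX : ∀ i : Fin 3, (X i : MvPolynomial (Fin 3) K) ∈ I := fun i => Ideal.subset_span (Set.mem_range_self i)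
  have hlin : (C α * X 0 + C β * X 1 : MvPolynomial (Fin 3) K) ∈ I :=
    I.add_mem (I.mul_mem_left _ (hX 0)) (I.mul_mem_left _ (hX 1))
  have hΨ : ((X 2 ^ 2 * (C α * X 0 + C β * X 1) + Ψ₁₀) + (C γ * X 2 ^ 4 + Ψ₂₀ + Ψ₅) : MvPolynomial (Fin 3) K) ∈ I ^ 3 := by
    refine Ideal.add_mem _ (Ideal.add_mem _ ?_ hΨ₁₀) (Ideal.add_mem _ (Ideal.add_mem _ ?_ ?_) ?_)
    · rw [pow_succ]
      exact Ideal.mul_mem_mul (Ideal.pow_mem_pow (hX 2) 2) hlin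
    · exact Ideal.mul_mem_left _ _ (Ideal.pow_le_pow_right (by norm_num) (Ideal.pow_mem_pow (hX 2) 4))
    · exact Ideal.pow_le_pow_right (by norm_num) hΨ₂₀
    · exact Ideal.pow_le_pow_right (by norm_num) hΨ₅
  obtain ⟨h0, h1, -⟩ := A_charts_regular_off_origin₂ K hΨ
  exact ⟨h0, h1⟩

/-- The evaluation at `e₂` kills `(y₀, y₁)`. [folklore] -/
theorem aeval_single₂_eq_zero_of_mem_span01 {p : MvPolynomial (Fin 3) K} (hp : p ∈ Ideal.span {(X 0 : MvPolynomial (Fin 3) K), X 1}) :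
    aeval (Pi.single 2 1 : Fin 3 → K) p = 0 := by
  have hle : Ideal.span {(X 0 : MvPolynomial (Fin 3) K), X 1} ≤ RingHom.ker (aeval (Pi.single 2 1 : Fin 3 → K)).toRingHom := by
    rw [Ideal.span_le]
    rintro _ (rfl | rfl)
    · simp [RingHom.mem_ker]
    · simp [RingHom.mem_ker]
  exact hle hp

/-- ★ **`A₃` recognition: the point is NOT first-order.**  With `Φ = y₀y₁` and the cubic form `Ψ₁ = y₂²(αy₀ + βy₁) + Ψ₁⁰`, `Ψ₁⁰ ∈ (y₀, y₁)`
(no `y₂³` term), the vector `b = e₂ ≠ 0` is a common zero of `Φ`, `∇Φ`, `Ψ₁`: the closed-point form of (FO) fails. [folklore] -/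
theorem A₃_recognition_not_firstOrder (α β : K) {Ψ₁₀ : MvPolynomial (Fin 3) K}
    (hΨ₁₀ : Ψ₁₀ ∈ Ideal.span {(X 0 : MvPolynomial (Fin 3) K), X 1}) :
    ¬ (∀ b : Fin 3 → K, aeval b (X 0 * X 1 : MvPolynomial (Fin 3) K) = 0 →
        (∀ i, aeval b (pderiv i (X 0 * X 1 : MvPolynomial (Fin 3) K)) = 0) →
        aeval b (X 2 ^ 2 * (C α * X 0 + C β * X 1) + Ψ₁₀ : MvPolynomial (Fin 3) K) = 0 → b = 0) := by
  intro h
  have hΨ : aeval (Pi.single 2 1 : Fin 3 → K) (X 2 ^ 2 * (C α * X 0 + C β * X 1) + Ψ₁₀ : MvPolynomial (Fin 3) K) = 0 := by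
    rw [map_add, aeval_single₂_eq_zero_of_mem_span01 K hΨ₁₀, add_zero, map_mul, map_add, map_mul, map_mul, aeval_X, aeval_X]
    simp
  have hb := h (Pi.single 2 1) (by simp) (fun i => by
    rw [pderiv_mul, map_add, map_mul, map_mul, aeval_X, aeval_X]
    simp) hΨ
  have h1 : (Pi.single 2 1 : Fin 3 → K) 2 = 0 := by rw [hb]; rfl
  simp at h1

end SecondOrderPoint

end Summit.ResolutionOfSingularities.ResolutionOfSingularities.Cruxes.EquisingularLiftNat.Sections

end
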